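import Mathlib
import HarnessLib
import HarnessLib.Audit
import Summits.AtomisticToContinuum.Statement

/-!
Route: UGibbsRigidity

CLOSED (retired) 2026-08-15T13:47:35Z by operator:999:1257524 — reason: not-a-thesis: assembly does not conclude the sub-problem Statement — note: D-0027 §2.1 audit (human 2026-08-15: routes that do not decide the summit are removed): the assembly concludes `Literature.MathematicalPhysics.KineticTheory.HydrodynamicLimit`, not the sub-problem statement; a NEW conforming route may be opened from the same idea (generated `closes : … → _root_.Hydr. The file is kept as the record of this route; refuted decls are indexed as negative knowledge (`ledger negatives`).

# Route UGibbsRigidity — u-Gibbs rigidity — the Boltzmann hypothesis posed and proved in the SRB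
class the hard-sphere flow propagates

X_u = U1 ∧ U2 ("it suffices to show"), realising card pesin-defect-u-gibbs-rigidity (spine) with
pesin-defect-prices-u-regularity as the foreseen
layer-2 split of U1. U1 (URegularLimits, INHERITANCE): for σ < σ₀, local Gibbs data and s < T, every
microscopic local limit (tag a typical
particle, recentre, blow up by ε_N⁻¹, N → ∞, Cesàro in a mesoscopic space-time window) of the
evolved law f^N_s is a translation-invariant,
flow-invariant state of the infinite hard-sphere dynamics carrying the Euler parameters (ρ_s, u_s,
θ_s)(x₀) and u-REGULAR: its conditional
measures on local unstable plaques are absolutely continuous (the SRB / u-Gibbs property of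
PesinSinai1982, LedrappierYoung1985). U2 (URigidity):
at packing < η₀ every translation-invariant, flow-invariant, u-regular state of finite density and
energy is a mixture of the hard-sphere Gibbs
states g_{z,u,β}. U1 ∧ U2 is OllaVaradhanYau1993's missing "strong ergodic theorem" restricted to
the class the dynamics cannot leave; fed into the
unchanged relative-entropy architecture it yields the typed target RelEntropyVanishing (shared,
stmt-AtomisticToContinuum-0766) and the conjunct.
U1, U2 are informal until the infinite-volume flow and u-regular states are defined (§ Definition
requests); the typed cruxes below are the three
N-UNIFORM finite-N inputs on which U1/U2 stand or fall: tempered (non-grazing) collision statistics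
and second moments of collision counts along
the evolved law, and positive dynamical entropy per particle per collision.
Lean: `∀ (a₀ θ₀ : Literature.MathematicalPhysics.KineticTheory.T3 → ℝ) (u₀ :
Literature.MathematicalPhysics.KineticTheory.T3 → Literature.MathematicalPhysics.KineticTheory.V3),
Continuous a₀ → Continuous θ₀ → Continuous u₀ → (∀ x, 0 < a₀ x) → (∀ x, 0 < θ₀ x) → ∃ σ₀ : ℝ, 0 < σ₀
∧ ∀ σ : ℝ, 0 < σ → σ < σ₀ → ∀ (T : ℝ) (ρ θ : ℝ → Literature.MathematicalPhysics.KineticTheory.T3 →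
ℝ) (u : ℝ → Literature.MathematicalPhysics.KineticTheory.T3 →
Literature.MathematicalPhysics.KineticTheory.V3),
Literature.MathematicalPhysics.KineticTheory.IsHardSphereEulerSolution σ T ρ u θ → ∀ Φ : (N : ℕ) →
Literature.Analysis.FluidPDE.HardSphereFlow (Literature.Analysis.FluidPDE.Torus.geometry (Fin 3))
(Literature.MathematicalPhysics.KineticTheory.hsDiameter σ N) (N + 1), (∀ N,
MeasureTheory.IsProbabilityMeasure (Literature.MathematicalPhysics.KineticTheory.localGibbsLaw σ a₀
u₀ θ₀ N (Φ N))) ∧ (Literature.MathematicalPhysics.KineticTheory.TendstoHydroFieldsAt (fun N =>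
Literature.MathematicalPhysics.KineticTheory.localGibbsLaw σ a₀ u₀ θ₀ N (Φ N)) Φ ρ u θ 0 → ∀ t ∈
Set.Ico 0 T, ∃ a : Literature.MathematicalPhysics.KineticTheory.T3 → ℝ, (∀ N,
MeasureTheory.IsProbabilityMeasure (Literature.MathematicalPhysics.KineticTheory.localGibbsLaw σ a
(u t) (θ t) N (Φ N))) ∧ (∀ χ : Literature.MathematicalPhysics.KineticTheory.T3 → ℝ, Continuous χ → ∀
δ : ℝ, 0 < δ → ∃ C : ℝ, 0 < C ∧ ∀ N : ℕ, Literature.MathematicalPhysics.KineticTheory.localGibbsLaw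
σ a (u t) (θ t) N (Φ N) {z | δ < |Literature.MathematicalPhysics.KineticTheory.empiricalDensityField
z χ - ∫ x, χ x * ρ t x|} ≤ ENNReal.ofReal (C * Real.exp (-(C⁻¹ * (N + 1)))) ∧
Literature.MathematicalPhysics.KineticTheory.localGibbsLaw σ a (u t) (θ t) N (Φ N) {z | δ <
‖Literature.MathematicalPhysics.KineticTheory.empiricalMomentumField z χ - ∫ x, (χ x * ρ t x) • u t
x‖} ≤ ENNReal.ofReal (C * Real.exp (-(C⁻¹ * (N + 1)))) ∧
Literature.MathematicalPhysics.KineticTheory.localGibbsLaw σ a (u t) (θ t) N (Φ N) {z | δ <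
|Literature.MathematicalPhysics.KineticTheory.empiricalEnergyField z χ - ∫ x, χ x *
Literature.MathematicalPhysics.KineticTheory.totalEnergyDensity (ρ t x) (u t x) (θ t x)|} ≤
ENNReal.ofReal (C * Real.exp (-(C⁻¹ * (N + 1))))) ∧ Filter.Tendsto (fun N : ℕ =>
InformationTheory.klDiv ((Φ N).lawAt (Literature.MathematicalPhysics.KineticTheory.localGibbsLaw σ
a₀ u₀ θ₀ N (Φ N)) t) (Literature.MathematicalPhysics.KineticTheory.localGibbsLaw σ a (u t) (θ t) N
(Φ N)) / ((N : ENNReal) + 1)) Filter.atTop (nhds 0))`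

## Assembly
Informally: U1 (URegularLimits) → U2 (URigidity) → GronwallU (OVY one-block/two-block for the
deterministic torus dynamics with the ergodic
input applied ONLY to dynamical local limits, which U1 places in the u-regular class and U2
classifies; large velocities and the virial
identification as in stmt-0781/0782, with 0781 re-posed with polynomial/truncated cubic moments per
the refuter flag) → RelEntropyVanishing;
the typed cruxes TemperedCollisions, CollisionMoments (existence and temperedness of the infinite
dynamics on local limits, N-uniform
distortion budget) and EntropyPerParticle (non-degeneracy of the class) are consumed inside U1/U2.
The typed assembly is the shared glue
RelEntropyVanishing → HydrodynamicLimit (stmt-AtomisticToContinuum-0769: entropy inequality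
KipnisLandim1999 App. 1 Prop. 8.2, fact
Literature.Probability.Entropy.KipnisLandim1999_A1_8_2, with λ(A) ≤ C e^(−(N+1)/C) and H = o(N);
lawAt = map (flow t)).

Rationale: WHY THIS LINE. OllaVaradhanYau1993 (Thm 2.1, §1 p. 525) add noise for one purpose — to classify
translation-invariant stationary states of finite specific
entropy as Gibbs mixtures — and the printed counterexamples to that classification (ideal gas, hard
rods: BoltzmannHypothesisBarrier) are exactly
the systems with NO expanding directions; for d ≥ 2 hard balls every orbit is completely hyperbolic
(SimanyiSzasz1999) and the Hopf chain is what
proves the Boltzmann–Sinai hypothesis at finite N (Simanyi2013). The line imports smooth ergodic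
theory (SRB/u-Gibbs states PesinSinai1982,
LedrappierYoung1985; their spatially extended uniqueness theory BricmontKupiainen1996,
KellerLiverani2009; Pesin theory with singularities
KatokEtAl1986) into the OVY architecture: pose the Boltzmann hypothesis in the regularity class the
flow propagates (a.c. unstable conditionals),
prove that evolved smooth laws cannot leave it (U1) and classify inside it by an infinite-volume
Ledrappier–Young/Hopf argument in which
translation invariance replaces transitivity (U2), the statistical-mechanics half being
Georgii1979-type equivalence of ensembles. Versus the
routes on file: RelEntropyErgodic (0779) asks the classification for ALL finite-entropy states,
ChaoticMixing asks N-uniform RATES,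
VanishingNoise keeps noise; this route asks no rate and no noise, only absolute continuity along the
one structure hard balls provably have, and
it files the N-uniform collision statistics (typed) that any such limit theory needs — none of which
is in the negatives index (empty).

RANKED CRUXES. Ranked: #2 URegularLimits (U1, INFORMAL until D1/D2 land; filed by `workitem add`
right after open) — every microscopic local limit of the
evolved local-Gibbs law f^N_s (s < T, σ < σ₀) is a translation-invariant, flow-invariant (infinite
Alexander dynamics), u-regular state with the
Euler parameters at the zoom point; u-regular = a.c. conditionals on local unstable plaques, posed
on Chernov homogeneity strips (why it might
fail: no growth lemma with N-uniform constants exists even for N discs — singularity complexity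
grows with N, BalintEtAl2002; sources
ChernovDolgopyat2009, SinaiChernov1987, KatokEtAl1986). #3 URigidity (U2, INFORMAL until D1–D3 land)
— at packing < η₀ every
translation-invariant, flow-invariant, u-regular state of finite density/energy of infinite hard
spheres in d = 3 is a mixture of g_{z,u,β}
(why it might fail: su-accessibility is local in particles; the σ-algebra saturated by local
su-holonomies AND translations must be generated by
the five conserved densities — an extensive non-local invariant would break it; sources
LedrappierYoung1985, SimanyiSzasz1999, GurevichSuhov1976,
Georgii1979, KellerLiverani2009). Then the typed N-uniform inputs #4–#6 below, the typed target #0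
and assembly #1 (both shared with
RelEntropyErgodic), and informal supports GronwallU (OVY Gronwall consuming U1 ∧ U2 only on
dynamical local limits) and FiniteNSanity (finite N:
flow-invariant u-regular laws on a shell are Liouville — the Hopf half of Simanyi2013, first prover
item once D2's finite-N part lands).
#0 RelEntropyVanishing (target) — Yau's relative-entropy form of the limit (shared target of
RelEntropyErgodic/VanishingNoise/ChaoticMixing, stmt-AtomisticToContinuum-0766): ∀ profiles ∃ σ₀ ∀ σ
< σ₀ ∀ classical hs-Euler solutions on [0,T) ∀ flows, the local Gibbs laws are probability measures
and, given the LLN at t = 0, for every t < T there is an activity profile a_t whose local Gibbs law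
concentrates exponentially around (ρ, ρu, E)(t) and H(f^N_t | localGibbs(a_t, u_t, θ_t))/(N+1) → 0.
Here it is reached as U1 → U2 → GronwallU (support) → this. (why it might fail: entropy production ≥
cN before the first shock for some smooth data (kills every entropy route); or U1 fails and local
limits leave the u-regular class, leaving the one-block step without an ergodic theorem.)
[OllaVaradhanYau1993, Yau1991, Spohn1991]
#4 TemperedCollisions (crux) — TEMPERED COLLISIONS, N-UNIFORM (the "tempered singularities" input of
Pesin/Katok–Strelcyn theory for the local limit states, card U1's first failure mode): for
continuous local-Gibbs profiles there is σ₀ such that for σ < σ₀ and every macroscopic t ≥ 0 there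
is C with, for all N and all hard-sphere flows Φ of N+1 spheres of diameter ε_N = σ(N+1)^(-1/3) on
𝕋³: the expectation under the local Gibbs law of the sum over the collisions of the orbit in [0, t]
of ε_N/|⟨x_i − x_j, v_i − v_j⟩| (the inverse normal relative speed 1/|w_n| of the colliding pair) is
≤ C (N+1)^(4/3) — i.e. O(1) per collision, as under the equilibrium flux measure (density ∝ |w_n|
d|w_n| near 0). [difficulty: L] (why it might fail: 1/|w_n| has no exponential moments under the
flux measure, so H(f_t|G)=O(N) transfers nothing; a concentration of the evolved law's two-particle
CONTACT density on near-grazing configurations (a Liouville-null set, invisible to entropy) breaks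
N-uniformity.) [KatokEtAl1986, BalintEtAl2002, SinaiChernov1987, ChernovDolgopyat2009]
#5 EntropyPerParticle (crux) — POSITIVE DYNAMICAL ENTROPY PER PARTICLE PER COLLISION, N-UNIFORM
(teeth of the u-regular class; the specific entropy of Sinai–Chernov's infinite equilibrium dynamics
is positive): there is σ₀ such that for σ < σ₀ there is c > 0 with, for all N ≥ 1 (at least two
spheres; one free particle has zero entropy) and all flows Φ, a finite measurable partition P of
phase space whose Kolmogorov–Sinai entropy rate under the equilibrium Gibbs law (activity 1, drift
0, temperature 1) for the macroscopic time-one map Φ₁ satisfies liminf_n n⁻¹ H(P ∨ Φ₁⁻¹P ∨ … ∨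
Φ₁^(−(n−1))P) ≥ c (N+1)^(4/3) = c' × (number of collisions per unit macroscopic time). [difficulty:
L] (why it might fail: Wojtkowski1988 (pp. 133–134) gets only ~√N·(rate): cone methods measure each
collision against the SYSTEM's previous collision (time ~1/(Nν)), not the particle's (~1/ν); an
N-uniform bound needs per-particle locality of expansion — the same wall as U1. May also be known
(Chernov 2000, acq-02322).) [Wojtkowski1988, SinaiChernov1987, LedrappierYoung1985,
doi:10.1007/978-3-662-04062-1_6]
#6 CollisionMoments (crux) — N-UNIFORM SECOND MOMENTS OF PER-PARTICLE COLLISION COUNTS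
(Alexander-regularity and singularity complexity of local limits, card U1's second failure mode):
for continuous local-Gibbs profiles there is σ₀ such that for σ < σ₀ and every t ≥ 0 there is C
with, for all N and Φ: Σ_i E[K_i(t)²] ≤ C (N+1)^(5/3) under the local Gibbs law, where K_i(t) is the
number of times in [0, t] at which particle i is in contact with some other particle (≍ (N+1)^(1/3)
in the mean). [difficulty: M] (why it might fail: n-ball clusters can realise exponentially many
collisions (BuragoIvanov2020; BFK bound (Cn^{3/2})^{n²}), so exponential moments are plausibly
infinite and entropy transfer from equilibrium fails; second moments then need cluster-size tails
along the NON-equilibrium law.) [BuragoFerlegerKononenko1998, BuragoIvanov2020, Alexander1976,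
GallagherSaintraymondTexier2013]

TWO-LAYER PLAN. U1 ⇐ UpperVolumeLemma → KiferYoungUpper → InfiniteVolumeLY → U1 (card
pesin-defect-prices-u-regularity: u-regularity PRICED by the Pesin-defect
large-deviation rate instead of inherited; k = 3). U2 ⇐ LocalMicrocanonical (stationary +
translation-invariant + u-regular ⇒ conditional law of a
window given exterior and local N, P, E is microcanonical: unstable holonomy from u-regularity,
stable holonomy by reversibility, local
su-accessibility of finite clusters SinaiChernov1987/SimanyiSzasz1999) → CanonicalToGibbs
(translation-invariant canonical-Gibbs states of the
dilute hard-sphere gas are mixtures of g_{z,u,β}: Georgii1979-type equivalence of ensembles at the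
level of specifications) → U2 (k = 2).
GronwallU ⇐ OneBlockU → LargeVelocityPolynomial → GronwallU (shared with RelEntropyErgodic 0780/0781
once re-posed). TemperedCollisions ⇐
EquilibriumFluxIdentity (collision-rate/flux formula under the invariant Gibbs law, provable) →
ContactDensityBound (two-particle contact density
of f_t ≤ C × equilibrium, N-uniform) → TemperedCollisions (k = 2). Nothing here is filed now.

KILL CRITERIA. A translation-invariant, flow-invariant, u-regular NON-Gibbs state of infinite hard
spheres at arbitrarily small packing (¬URigidity) closes the
route `refuted:URigidity` (and kills RelEntropyErgodic's 0779 a fortiori). ¬TemperedCollisions or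
¬CollisionMoments by super-polynomial growth in
N forces a PIVOT, not a close: U1 must then be re-posed on Chernov homogeneity strips / patch-local
plaques (restate URegularLimits with
"u-regular on a countable union of plaques of summable weights"); a refutation showing the evolved
law's contact density concentrates on grazing
configurations at a rate growing with N kills U1 outright → close `refuted:URegularLimits`.
¬EntropyPerParticle (entropy per collision → 0 along
N → ∞ at fixed σ) empties the u-regular class of content → close unless the refutation is a
formalisation artefact (then restate). RelEntropyVanishing
refuted (entropy production ≥ cN before shocks) closes this and every entropy route. GibbsErgodicity
(0779) proved elsewhere moots U1/U2 (route
superseded by RelEntropyErgodic); UniformLocalMixing (ChaoticMixing) proved elsewhere supersedes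
GronwallU's input.

NOT DECOMPOSED YET. The infinite-volume objects (Alexander flow on PointConfig(ℝ³×ℝ³), local
unstable plaques, u-regular states, specific entropy, g_{z,u,β}) are
definition requests, so U1/U2 are filed informal and unsplit; the precise plaque class (log-Hölder
densities vs. homogeneity strips) is
deliberately left open until TemperedCollisions/CollisionMoments report; the five-field ergodic
decomposition inside U2, the Cesàro/convexity
bookkeeping passing u-regularity to OVY's averaged limit points, the re-posed large-velocity bound
(0781) and the virial identification (0782) are
layer-2 children or shared items; constants σ₀, η₀ are not tracked (cluster-expansion radius).

CHEAPEST FALSIFIER. (i) LOOKUP: is an N-linear lower bound h_N ≥ c·N·ν for the KS entropy of N hard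
balls at fixed small packing already in print (Chernov 2000
"Entropy values and entropy bounds", doi:10.1007/978-3-662-04062-1_6, paywalled here: acq-02322;
Sinai–Chernov 1982 space-time entropy)? If yes
EntropyPerParticle is `known` → support. Wojtkowski1988 pp. 133–134 (read) says his bound is ~√N and
does NOT give positivity of the entropy per
particle. (ii) TWO-BODY COMPUTATION (done by hand, recorded for refuters): under the equilibrium
collision flux the normal relative speed s = |w_n|
has density ∝ s ds at 0, so E[s^(−a)] < ∞ iff a < 2 — TemperedCollisions (a = 1) is an identity at
equilibrium and its content is purely
non-equilibrium/N-uniform; but the naive per-collision DISTORTION of plaque densities (∝ 1/cos²φ)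
has a log-divergent first moment (∫ tan φ dφ), so
U1 "with log-Hölder densities on plaques of uniform size" is false as naively stated and MUST be
posed with homogeneity strips (ChernovDolgopyat2009
growth lemmas) — the informal U1 below says so. (iii) d = 2 (hard discs) versions of the three typed
cruxes are the first arena: if N-uniformity
fails already for discs, retire the line.

NUMBERS. Scaling (macroscopic units, N+1 spheres of diameter ε_N = σ(N+1)^(−1/3) on 𝕋³): collision
rate per particle ν_N ≍ σ²√θ (N+1)^(1/3); total
collisions in [0,t] ≍ (N+1)^(4/3); per-particle count K_i ≍ (N+1)^(1/3), so Σ_i K_i² ≍ (N+1)^(5/3);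
expected Σλ⁺ per unit time ≍ (N+1)·ν_N·2 log(mean
free path/diameter) ≍ (N+1)^(4/3) log(1/σ³), = KS entropy by the Pesin formula for the smooth
invariant law (finite N). Known: h_N > 0 for each N
(Sinai; SinaiChernov1987), thermodynamic limit of h_N/N exists at small density and equals the
space-time entropy of the infinite system
(Sinai–Chernov 1982, cited in Wojtkowski1988 p. 133), Wojtkowski1988 lower bound ≍ √N only. Flux
measure: P(|w_n| < δ) ∝ δ². Collision
combinatorics: ≤ (C n^(3/2))^(n²) collisions for n balls in free space
(BuragoFerlegerKononenko1998), ≥ exponentially many realisable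
(BuragoIvanov2020). SRB template: invariant + a.c. unstable conditionals ⇔ Pesin formula
(LedrappierYoung1985 Thm A). Items at open: 5 typed
(target, 3 cruxes, assembly) + 2 informal cruxes + 2 informal supports filed right after open = 9 ≤
15.

DEFINITION REQUESTS. Filed right after open (ids in NOTES.md): D1 `InfiniteHardSphereFlow` (topic
Literature/Analysis/FluidPDE): hypothesis structure à la
`Literature.Analysis.FunctionSpaces.LorentzFlow` over `PointConfig (ℝ³ × ℝ³)` with hard core — good
set, group law, measurability, orbits are
hard-sphere trajectories particle-wise, translation covariance — plus the named fact of its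
existence for translation-invariant laws of finite
density/energy (Alexander1976); shared need of 0779. D2 `URegularState` (topic
Summits/AtomisticToContinuum/HydrodynamicLimit/Theorems, posited
object): local unstable plaques of the infinite flow for a finite particle set given the exterior's
backward data, and "u-regular" =
conditionals on plaques a.c. (with the homogeneity-strip variant); finite-N deliverable first:
unstable manifolds of `HardSphereFlow` on 𝕋^d
(SinaiChernov1987, KatokEtAl1986). D3 `HardSphereGibbsState` (topic
Literature/MathematicalPhysics/StatisticalMechanics): grand-canonical hard-sphere
Gibbs laws g_{z,u,β} on PointConfig(ℝ³×ℝ³), Gibbs mixtures, specific entropy/energy/density of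
translation-invariant laws (Ruelle1969 §3.4,
Georgii1979); shared need of 0779/0782.

Novelty: Searches (2026-08-15): `lit frontier AtomisticToContinuum --since 2020` (30 rows; only
deterministic-hydrodynamics hit CanestrariLiveraniOlla2026,
no SRB/u-Gibbs × hydrodynamic-limit paper); `lit bridges AtomisticToContinuum --cross any` (30 rows,
none ergodic-theoretic); `lit search --source
crossref "Wojtkowski measure theoretic entropy system of hard spheres"` (→ Wojtkowski1988, READ pp.
133–134: entropy-per-particle positivity not
established); `… "Chernov entropy values entropy bounds hard ball"` (→
doi:10.1007/978-3-662-04062-1_6, paywalled, acq-02322); `… "Burago Ivanov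
exponentially many collisions"` (→ BuragoIvanov2020); `lit galaxy search "entropy of the system of
hard spheres" --star all` (3 rows: LNM 1486
reference list, ICM90, one convex-billiard arXiv — nothing on N-uniformity); OpenAlex budget
exhausted (HTTP 429) this session; the card's own
searches (Keller–Liverani, Ledrappier–Young, Gurevich–Suhov, barrier files, 117 cards) stand; ledger
negatives (0).
Nearest prior art found: LedrappierYoung1985 (doi:10.2307/1971328) + PesinSinai1982
(finite-dimensional u-Gibbs/SRB rigidity); BricmontKupiainen1996,
KellerLiverani2009 (unique SRB state for infinite lattices of weakly coupled hyperbolic maps, incl.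
"map lattices coupled by collisions");
OllaVaradhanYau1993 Thm 2.1 / LiveraniOlla1996 Thm 1.2 / FritzFunakiLebowitz1994 (classification
WITH noise); Simanyi2013 (finite-N Hopf
machinery); Wojtkowski1988 (entropy of hard spheres, √N).
Delta: nobody in the searched  [refs: 10.1007/978-3-662-04062-1_6, 10.2307/1971328, doi:10.1007/978-3-662-04062-1_6, doi:10.2307/1971328, CanestrariLiveraniOlla2026, Wojtkowski1988, BuragoIvanov2020, LedrappierYoung1985, PesinSinai1982, BricmontKupiainen1996, KellerLiverani2009, OllaVaradhanYau1993, LiveraniOlla1996, FritzFunakiLebowitz1994, Simanyi2013]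

Barriers (technique_class: u-gibbs srb-rigidity hopf-argument relative-entropy): - technique_class: u-gibbs srb-rigidity hopf-argument relative-entropy
- Literature.Barriers.AtomisticToContinuum.BoltzmannHypothesisBarrier: met head-on and evaded by
proof in a smaller class: its formal kernel (ideal gas: stationary states indexed by arbitrary
velocity laws; hard rods) has no expanding directions, so u-regularity is vacuous there and
URigidity is stated only for d = 3 colliding hard spheres at packing < η₀ where Σλ⁺ > 0
(EntropyPerParticle is the quantitative form of "collisions present").
- Literature.Barriers.AtomisticToContinuum.MacroErgodicityBarrier: same missing input on the
diffusive scale for chains; its sector-condition kernel is irrelevant at Euler scaling (no Dirichlet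
form); oscillator chains have no hyperbolicity, consistent with the line's logic (it claims nothing
there).
- Literature.Barriers.AtomisticToContinuum.HighMomentumCutoffBarrier: bites downstream in GronwallU
(cubic energy current with true KE); shared with 0781, which must be re-posed with
polynomial/truncated moments (refuter flag) — conceded, not evaded by this line's mechanism.
- Literature.Barriers.AtomisticToContinuum.HighMomentumCutoffBarrierNarrow: it does not evade it;
the bet is a NEW A-PRIORI INPUT — the N-uniform collision statistics of this route
(CollisionMoments, TemperedCollisions) plus polynomial/truncated control of the cubic velocity
moments along f_t (0781 re-posed) in place of the exponential moments of p|p|²/2 that Maxwellian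
references lack; conceded as Gronwa

History (route lifecycle, newest last):
- 2026-08-15T13:47:35Z · CLOSED retired — not-a-thesis: assembly does not conclude the sub-problem Statement (operator:999:1257524)

sub-problem: HydrodynamicLimit · status: closed(retired) · opened planner-plancard-AtomisticToContinuum-Hydrody-14bc9e05-0 2026-08-15T11:31:15Z · rev 2 · ledger route-AtomisticToContinuum-UGibbsRigidity
GENERATED by the gate from the ledger (D-0016/17). Provers cite these decls: `theorem foo : Summit.AtomisticToContinuum.HydrodynamicLimit.Theses.UGibbsRigidity.<Decl> := …` in Summits/AtomisticToContinuum/HydrodynamicLimit/Theorems/<Name>.lean.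
-/

namespace Summit.AtomisticToContinuum.HydrodynamicLimit.Theses.UGibbsRigidity

open scoped BigOperators Topology Manifold Classical MeasureTheory ProbabilityTheory Matrix InnerProductSpace ComplexConjugate ContinuousMap
open Filter Set Function TopologicalSpace MeasureTheory

attribute [summit_statement] _root_.HydrodynamicLimit

/-- item stmt-AtomisticToContinuum-0766 · target · rank 0 · open · by planner
why it might fail: entropy production ≥ cN before the first shock for some smooth data (kills every entropy route); or U1 fails and local limits leave the u-regular class, leaving the one-block step without an ergodic theorem.
sources: OllaVaradhanYau1993, Yau1991, Spohn1991
[target] X_RE: for all continuous profiles ∃ σ₀ ∀ σ<σ₀ ∀ classical hs-Euler solutions on [0,T) ∀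
flows: the initial local Gibbs laws are probability measures and, if their fields converge at t=0,
then ∀ t<T ∃ activity profile a_t such that the reference local Gibbs law (a_t, u_t, θ_t) is a
probability measure whose empirical density/momentum/energy fields concentrate exponentially (≤ C
e^{-(N+1)/C}) around (ρ,ρu,E)(t), and klDiv(lawAt Φ_N (localGibbs a₀u₀θ₀) t ‖ localGibbs a_t u_t
θ_t)/(N+1) → 0. Yau1991; OllaVaradhanYau1993 Thm 1.1 (with noise). -/
@[route_item "route-AtomisticToContinuum-UGibbsRigidity"]
def RelEntropyVanishing : Prop :=
  ∀ (a₀ θ₀ : Literature.MathematicalPhysics.KineticTheory.T3 → ℝ) (u₀ : Literature.MathematicalPhysics.KineticTheory.T3 → Literature.MathematicalPhysics.KineticTheory.V3), Continuous a₀ → Continuous θ₀ → Continuous u₀ → (∀ x, 0 < a₀ x) → (∀ x, 0 < θ₀ x) → ∃ σ₀ : ℝ, 0 < σ₀ ∧ ∀ σ : ℝ, 0 < σ → σ < σ₀ → ∀ (T : ℝ) (ρ θ : ℝ → Literature.MathematicalPhysics.KineticTheory.T3 → ℝ) (u : ℝ → Literature.MathematicalPhysics.KineticTheory.T3 → Literature.MathematicalPhysics.KineticTheory.V3),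 Literature.MathematicalPhysics.KineticTheory.IsHardSphereEulerSolution σ T ρ u θ → ∀ Φ : (N : ℕ) → Literature.Analysis.FluidPDE.HardSphereFlow (Literature.Analysis.FluidPDE.Torus.geometry (Fin 3)) (Literature.MathematicalPhysics.KineticTheory.hsDiameter σ N) (N + 1), (∀ N, MeasureTheory.IsProbabilityMeasure (Literature.MathematicalPhysics.KineticTheory.localGibbsLaw σ a₀ u₀ θ₀ N (Φ N))) ∧ (Literature.MathematicalPhysics.KineticTheory.TendstoHydroFieldsAt (fun N => Literature.MathematicalPhysics.KineticTheory.localGibbsLaw σ a₀ u₀ θ₀ N (Φ N)) Φ ρ u θ 0 → ∀ t ∈ Set.Ico 0 T, ∃ a : Literature.MathematicalPhysics.KineticTheory.T3 → ℝ, (∀ N, MeasureTheory.IsProbabilityMeasure (Literature.MathematicalPhysics.KineticTheory.localGibbsLaw σ a (u t) (θ t) N (Φ N))) ∧ (∀ χ : Literature.MathematicalPhysics.KineticTheory.T3 → ℝ, Continuous χ → ∀ δ : ℝ, 0 < δ → ∃ C : ℝ, 0 < C ∧ ∀ N : ℕ, Literature.MathematicalPhysics.KineticTheory.localGibbsLaw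 σ a (u t) (θ t) N (Φ N) {z | δ < |Literature.MathematicalPhysics.KineticTheory.empiricalDensityField z χ - ∫ x, χ x * ρ t x|} ≤ ENNReal.ofReal (C * Real.exp (-(C⁻¹ * (N + 1)))) ∧ Literature.MathematicalPhysics.KineticTheory.localGibbsLaw σ a (u t) (θ t) N (Φ N) {z | δ < ‖Literature.MathematicalPhysics.KineticTheory.empiricalMomentumField z χ - ∫ x, (χ x * ρ t x) • u t x‖} ≤ ENNReal.ofReal (C * Real.exp (-(C⁻¹ * (N + 1)))) ∧ Literature.MathematicalPhysics.KineticTheory.localGibbsLaw σ a (u t) (θ t) N (Φ N) {z | δ < |Literature.MathematicalPhysics.KineticTheory.empiricalEnergyField z χ - ∫ x, χ x * Literature.MathematicalPhysics.KineticTheory.totalEnergyDensity (ρ t x) (u t x) (θ t x)|} ≤ ENNReal.ofReal (C * Real.exp (-(C⁻¹ * (N + 1))))) ∧ Filter.Tendsto (fun N : ℕ => InformationTheory.klDiv ((Φ N).lawAt (Literature.MathematicalPhysics.KineticTheory.localGibbsLaw σ a₀ u₀ θ₀ N (Φ N)) t) (Literature.MathematicalPhysics.KineticTheory.localGibbsLaw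 σ a (u t) (θ t) N (Φ N)) / ((N : ENNReal) + 1)) Filter.atTop (nhds 0))

-- item stmt-AtomisticToContinuum-5102 · crux · rank 2 · closed · moot by None · by planner — informal only, no Lean statement yet:
--   [crux] U-REGULAR LOCAL LIMITS (card pesin-defect-u-gibbs-rigidity U1, INHERITANCE): there is σ₀ > 0
--   such that for 0 < σ < σ₀, continuous local-Gibbs profiles (a₀, u₀, θ₀), a classical hs-Euler
--   solution on [0,T) and s < T, every MICROSCOPIC LOCAL LIMIT of the evolved law f^N_s = lawAt Φ_N
--   (localGibbsLaw σ a₀ u₀ θ₀) s — tag a typical particle, recentre at it, blow positions up by ε_N⁻¹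
--   (spheres of diameter 1, density σ³), Cesàro-average over a mesoscopic space-time window, let N → ∞
--   along a subsequence; a probability law on PointConfig(ℝ³ × ℝ³) — is (i) translation invariant, (ii)
--   supported on c

-- item stmt-AtomisticToContinuum-5572 · crux · rank 3 · closed · moot by None · by planner — informal only, no Lean statement yet:
--   [crux] U-GIBBS RIGIDITY IN INFINITE VOLUME (card pesin-defect-u-gibbs-rigidity U2): there is η₀ > 0
--   such that every probability law ν on locally finite hard-sphere configurations PointConfig(ℝ³ × ℝ³)
--   (diameter 1, d = 3 — NOT general d: hard rods d = 1 are a counterexample) that is translation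
--   invariant, supported on Alexander-good configurations and invariant under the infinite hard-sphere
--   flow, of density < η₀, finite specific kinetic energy, and u-REGULAR (absolutely continuous
--   conditional measures on local unstable plaques, as in URegularLimits (iv)) is a mixture of the
--   grand-canonical hard

/-- item stmt-AtomisticToContinuum-4275 · crux · rank 4 · closed · moot by None · by planner
why it might fail: 1/|w_n| has no exponential moments under the flux measure, so H(f_t|G)=O(N) transfers nothing; a concentration of the evolved law's two-particle CONTACT density on near-grazing configurations (a Liouville-null set, invisible to entropy) breaks N-uniformity.
sources: KatokEtAl1986, BalintEtAl2002, SinaiChernov1987, ChernovDolgopyat2009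
[crux] TEMPERED COLLISIONS, N-UNIFORM (the "tempered singularities" input of Pesin/Katok–Strelcyn
theory for the local limit states, card U1's first failure mode): for continuous local-Gibbs
profiles there is σ₀ such that for σ < σ₀ and every macroscopic t ≥ 0 there is C with, for all N and
all hard-sphere flows Φ of N+1 spheres of diameter ε_N = σ(N+1)^(-1/3) on 𝕋³: the expectation under
the local Gibbs law of the sum over the collisions of the orbit in [0, t] of ε_N/|⟨x_i − x_j, v_i −
v_j⟩| (the inverse normal relative speed 1/|w_n| of the colliding pair) is ≤ C (N+1)^(4/3) — i.e.
O(1) per collision, as under the equilibrium flux measure (density ∝ |w_n| d|w_n| near 0).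
[difficulty: L] -/
@[route_item "route-AtomisticToContinuum-UGibbsRigidity"]
def TemperedCollisions : Prop :=
  ∀ (a₀ θ₀ : Literature.MathematicalPhysics.KineticTheory.T3 → ℝ) (u₀ : Literature.MathematicalPhysics.KineticTheory.T3 → Literature.MathematicalPhysics.KineticTheory.V3), Continuous a₀ → Continuous θ₀ → Continuous u₀ → (∀ x, 0 < a₀ x) → (∀ x, 0 < θ₀ x) → ∃ σ₀ : ℝ, 0 < σ₀ ∧ ∀ σ : ℝ, 0 < σ → σ < σ₀ → ∀ t : ℝ, 0 ≤ t → ∃ C : ℝ, ∀ (N : ℕ) (Φ : Literature.Analysis.FluidPDE.HardSphereFlow (Literature.Analysis.FluidPDE.Torus.geometry (Fin 3)) (Literature.MathematicalPhysics.KineticTheory.hsDiameter σ N) (N + 1)), ∫⁻ z, ENNReal.ofReal (∑ᶠ τ ∈ Literature.Analysis.FluidPDE.collisionTimes (Literature.Analysis.FluidPDE.Torus.geometry (Fin 3)) (Literature.MathematicalPhysics.KineticTheory.hsDiameter σ N) (fun s => Φ.flow s z) ∩ Set.Icc 0 t, ∑ i : Fin (N + 1), ∑ j ∈ Finset.univ.erase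 i, (Literature.Analysis.FluidPDE.contactSet (Literature.Analysis.FluidPDE.Torus.geometry (Fin 3)) (N + 1) (Literature.MathematicalPhysics.KineticTheory.hsDiameter σ N) i j).indicator (fun y : Literature.Analysis.FluidPDE.Config (N + 1) (Fin 3) Literature.MathematicalPhysics.KineticTheory.T3 => Literature.MathematicalPhysics.KineticTheory.hsDiameter σ N / |inner ℝ ((Literature.Analysis.FluidPDE.Torus.geometry (Fin 3)).sepVec (y i).1 (y j).1) ((y i).2 - (y j).2)|) (Φ.flow τ z)) ∂(Literature.MathematicalPhysics.KineticTheory.localGibbsLaw σ a₀ u₀ θ₀ N Φ) ≤ ENNReal.ofReal (C * ((N : ℝ) + 1) ^ (4 / 3 : ℝ))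

/-- item stmt-AtomisticToContinuum-4276 · crux · rank 5 · closed · moot by None · by planner
why it might fail: Wojtkowski1988 (pp. 133–134) gets only ~√N·(rate): cone methods measure each collision against the SYSTEM's previous collision (time ~1/(Nν)), not the particle's (~1/ν); an N-uniform bound needs per-particle locality of expansion — the same wall as U1. May also be known (Chernov 2000, acq-02322).
sources: Wojtkowski1988, SinaiChernov1987, LedrappierYoung1985, doi:10.1007/978-3-662-04062-1_6
[crux] POSITIVE DYNAMICAL ENTROPY PER PARTICLE PER COLLISION, N-UNIFORM (teeth of the u-regular
class; the specific entropy of Sinai–Chernov's infinite equilibrium dynamics is positive): there is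
σ₀ such that for σ < σ₀ there is c > 0 with, for all N ≥ 1 (at least two spheres; one free particle
has zero entropy) and all flows Φ, a finite measurable partition P of phase space whose
Kolmogorov–Sinai entropy rate under the equilibrium Gibbs law (activity 1, drift 0, temperature 1)
for the macroscopic time-one map Φ₁ satisfies liminf_n n⁻¹ H(P ∨ Φ₁⁻¹P ∨ … ∨ Φ₁^(−(n−1))P) ≥ c
(N+1)^(4/3) = c' × (number of collisions per unit macroscopic time). [difficulty: L] -/
@[route_item "route-AtomisticToContinuum-UGibbsRigidity"]
def EntropyPerParticle : Prop :=
  ∃ σ₀ : ℝ, 0 < σ₀ ∧ ∀ σ : ℝ, 0 < σ → σ < σ₀ → ∃ c : ℝ, 0 < c ∧ ∀ (N : ℕ) (Φ : Literature.Analysis.FluidPDE.HardSphereFlow (Literature.Analysis.FluidPDE.Torus.geometry (Fin 3)) (Literature.MathematicalPhysics.KineticTheory.hsDiameter σ N) (N + 1)), 1 ≤ N → ∃ (k : ℕ) (P : Fin k → Set (Literature.Analysis.FluidPDE.Config (N + 1) (Fin 3) Literature.MathematicalPhysics.KineticTheory.T3)), (∀ i, MeasurableSet (P i)) ∧ Pairwise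 (Function.onFun Disjoint P) ∧ (⋃ i, P i) = Set.univ ∧ c * ((N : ℝ) + 1) ^ (4 / 3 : ℝ) ≤ Filter.liminf (fun n : ℕ => (n : ℝ)⁻¹ * ∑ w : Fin n → Fin k, -((Literature.MathematicalPhysics.KineticTheory.localGibbsLaw σ (fun _ => 1) (fun _ => 0) (fun _ => 1) N Φ).real (⋂ m : Fin n, (Φ.flow 1)^[m.val] ⁻¹' P (w m)) * Real.log ((Literature.MathematicalPhysics.KineticTheory.localGibbsLaw σ (fun _ => 1) (fun _ => 0) (fun _ => 1) N Φ).real (⋂ m : Fin n, (Φ.flow 1)^[m.val] ⁻¹' P (w m))))) Filter.atTop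

/-- item stmt-AtomisticToContinuum-4277 · crux · rank 6 · closed · moot by None · by planner
why it might fail: n-ball clusters can realise exponentially many collisions (BuragoIvanov2020; BFK bound (Cn^{3/2})^{n²}), so exponential moments are plausibly infinite and entropy transfer from equilibrium fails; second moments then need cluster-size tails along the NON-equilibrium law.
sources: BuragoFerlegerKononenko1998, BuragoIvanov2020, Alexander1976, GallagherSaintraymondTexier2013
[crux] N-UNIFORM SECOND MOMENTS OF PER-PARTICLE COLLISION COUNTS (Alexander-regularity and
singularity complexity of local limits, card U1's second failure mode): for continuous local-Gibbs
profiles there is σ₀ such that for σ < σ₀ and every t ≥ 0 there is C with, for all N and Φ: Σ_i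
E[K_i(t)²] ≤ C (N+1)^(5/3) under the local Gibbs law, where K_i(t) is the number of times in [0, t]
at which particle i is in contact with some other particle (≍ (N+1)^(1/3) in the mean). [difficulty:
M] -/
@[route_item "route-AtomisticToContinuum-UGibbsRigidity"]
def CollisionMoments : Prop :=
  ∀ (a₀ θ₀ : Literature.MathematicalPhysics.KineticTheory.T3 → ℝ) (u₀ : Literature.MathematicalPhysics.KineticTheory.T3 → Literature.MathematicalPhysics.KineticTheory.V3), Continuous a₀ → Continuous θ₀ → Continuous u₀ → (∀ x, 0 < a₀ x) → (∀ x, 0 < θ₀ x) → ∃ σ₀ : ℝ, 0 < σ₀ ∧ ∀ σ : ℝ, 0 < σ → σ < σ₀ → ∀ t : ℝ, 0 ≤ t → ∃ C : ℝ, ∀ (N : ℕ) (Φ : Literature.Analysis.FluidPDE.HardSphereFlow (Literature.Analysis.FluidPDE.Torus.geometry (Fin 3)) (Literature.MathematicalPhysics.KineticTheory.hsDiameter σ N) (N + 1)), ∫⁻ z, ∑ i : Fin (N + 1), ((Set.ncard {τ : ℝ | τ ∈ Set.Icc 0 t ∧ ∃ j : Fin (N + 1), j ≠ i ∧ Φ.flow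 τ z ∈ Literature.Analysis.FluidPDE.contactSet (Literature.Analysis.FluidPDE.Torus.geometry (Fin 3)) (N + 1) (Literature.MathematicalPhysics.KineticTheory.hsDiameter σ N) i j} : ENNReal)) ^ 2 ∂(Literature.MathematicalPhysics.KineticTheory.localGibbsLaw σ a₀ u₀ θ₀ N Φ) ≤ ENNReal.ofReal (C * ((N : ℝ) + 1) ^ (5 / 3 : ℝ))

-- item stmt-AtomisticToContinuum-5132 · support · rank 2 · closed · moot by None · by planner — informal only, no Lean statement yet:
--   probe

-- item stmt-AtomisticToContinuum-5478 · support · rank 2 · closed · moot by None · by planner — informal only, no Lean statement yet: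
--   [crux] U-REGULAR LOCAL LIMITS (card pesin-defect-u-gibbs-rigidity U1, INHERITANCE): there is σ₀ > 0
--   such that for 0 < σ < σ₀, continuous local-Gibbs profiles (a₀, u₀, θ₀), a classical hs-Euler
--   solution on [0,T) and s < T, every MICROSCOPIC LOCAL LIMIT of the evolved law f^N_s = lawAt Φ_N
--   (localGibbsLaw σ a₀ u₀ θ₀) s — tag a typical particle, recentre at it, blow positions up by ε_N⁻¹
--   (spheres of diameter 1, density σ³), Cesàro-average over a mesoscopic space-time window, let N → ∞
--   along a subsequence; a probability law on PointConfig(ℝ³ × ℝ³) — is (i) translation invariant, (ii)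
--   supported on c

-- item stmt-AtomisticToContinuum-5688 · support · rank 9 · closed · moot by None · by planner — informal only, no Lean statement yet:
--   [support] RELATIVE-ENTROPY GRONWALL CONSUMING ONLY DYNAMICAL LOCAL LIMITS (card U3; the
--   route-specific form of RelEntropyErgodic stmt-0780): with f^N_t the law lawAt Φ_N (localGibbsLaw σ
--   a₀ u₀ θ₀) t and ψ^N_t the local Gibbs law with parameters (a(ρ_t,σ), u_t, θ_t) built on a classical
--   hs-Euler solution on [0,T): for t < T, H(f^N_t | ψ^N_t) ≤ H(f^N_0 | ψ^N_0) + C ∫_0^t H(f^N_s |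
--   ψ^N_s) ds + o(N), where the one-block/two-block replacement (space-time block averages of the
--   microscopic momentum/energy currents are asymptotically their Gibbs expectations at the
--   block-averaged conserved fields) inv

-- item stmt-AtomisticToContinuum-5712 · support · rank 9 · closed · moot by None · by planner — informal only, no Lean statement yet:
--   [support] FINITE-N u-GIBBS SANITY THEOREM (card U4; first prover item once the finite-N part of D2
--   lands): for d ≥ 2, N ≥ 2 unit-mass balls of diameter ε on 𝕋^d with connected configuration-space
--   interior and a hard-sphere flow Φ (Literature.Analysis.FluidPDE.HardSphereFlow (Torus.geometry d) ε
--   N): every Borel probability measure on the zero-momentum energy surface Y_e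
--   (Literature.MathematicalPhysics.KineticTheory.zeroMomentumEnergyShell) that is invariant under every
--   Φ_t and under the diagonal translations translateAll, and whose conditional measures on local
--   unstable manifolds of Φ are absol

/-- item stmt-AtomisticToContinuum-0769 · assembly · rank 1 · open · by planner
sources: KipnisLandim1999, OllaVaradhanYau1993
[assembly] X_RE → HydrodynamicLimit: entropy inequality μ(A) ≤ (log 2 + H(μ|λ))/log(1 + 1/λ(A))
(from Donsker–Varadhan / Mathlib klDiv API) with λ(A) ≤ C e^{-(N+1)/C} and H = o(N) gives μ(A) → 0;
μ = lawAt (Φ N) P t = P.map (flow t) turns μ{z | δ < |field z − ·|} into P{z | δ < |field (flow t z)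
− ·|} (measurable_flow); the reference concentration is stated for z itself and TendstoHydroFieldsAt
at time 0 of the reference law is not needed. Zero-mass case impossible by the IsProbabilityMeasure
clauses; take σ₀ from X_RE. -/
@[route_item "route-AtomisticToContinuum-UGibbsRigidity"]
def Assembly : Prop :=
  RelEntropyVanishing → Literature.MathematicalPhysics.KineticTheory.HydrodynamicLimit

end Summit.AtomisticToContinuum.HydrodynamicLimit.Theses.UGibbsRigidity
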